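import Literature.NumberTheory.EllipticCurves.ZpExtensionEisensteinTwistCoresUnramified
import Literature.NumberTheory.EllipticCurves.ZpExtensionEisensteinSelmerStructure
import HarnessLib

/-!
# The finite-level control map and a LOCALLY defined quotient: `coresEisenstein N θ` dies modulo a
# `Γ_L`-stable plus part whenever every conjugate of `θ` is, on `φ⁻¹N`, a coboundary modulo the plus part;
# in particular its localisation at `v ∣ p` lies in the STRICT ORDINARY core (theorems only; no named fact)

Topic `NumberTheory/EllipticCurves` (sequel of `ZpExtensionEisensteinTwistCoresUnramified`, the «unramified at `v ∤ p`»
half). Cell `pub/bsd-print-x9`, D1 road of the shared μ-residual of rows 9/10: the «`v ∣ p`, ordinary» local clause of the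
Selmer compatibility `f(𝔖) ⊆ H¹_{F_𝔮}(K, T_𝔮)` of the compact control map (Howard, *Compos. Math.* 140 (2004), §2.2,
Lemma 2.2.7 / Prop. 2.2.8; the Selmer structure `F_𝔮` at `v ∣ p` is the saturation of the strict ordinary cores
`ker (H¹(K_v, W_k) → H¹(K_v, W_k / Fil_v W_k))`, `ZpExtensionEisensteinSelmerStructure`).

For `κ : ZpExtension K p`, `ρ : DiscreteGaloisModule K M`, `m ≥ 1`, `k`, `J = eisensteinLevel hm k`, an open normal subgroup
`N ≤ Γ_J` of finite index, a continuous `φ : Γ_L → Γ_K` (intended: `Γ_{K_v} → Γ_K`), a submodule `Fil ≤ M` and a submodule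
`TW ≤ W = M ⊗ A_{m,k}(ψ)` stable under `Γ_L` (through `φ` and the twisted action) and containing the pure tensors `c ⊗ a`,
`a ∈ Fil` (intended: `Fil = Fil_v E[p^k]`, `TW = Fil_v W_k = A_{m,k} ⊗ Fil_v E[p^k]`, `OrdinaryFiltration.twistedFil`):

* **`map_coresEisenstein_mkQ_eq_zero`**: if for every `g ∈ Γ_K` the conjugate cocycle `g · z` is, on `φ⁻¹N`, congruent
  modulo `Fil` to a coboundary of `M` (`∃ y, ∀ h ∈ φ⁻¹N, g z(g⁻¹ φ(h) g) − (φ(h) y − y) ∈ Fil`), then the class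
  `cor_N^{Γ_K}(1 ⊗ [z]) ∈ H¹(K, W)` dies along the pair `(φ, W → W/TW)`, i.e. in `H¹(Γ_L, W / TW)`. Mechanism: Mackey
  (`map_cores_eq_zero`) as in the unramified case; `g · (1 ⊗ z) = (1+T)^{e(g)} • (1 ⊗ g·z)`
  (`eisensteinTwist_eisensteinUnitCoeff`); a value `φ(h) y − y + f` with `f ∈ Fil` maps to the coboundary of
  `(1+T)^{e} • (1 ⊗ y)` plus `(1+T)^e ⊗ f ∈ TW`, killed by the quotient map.
* `quotientMap_pullback_eq_map` — plumbing: `H¹(W → W/TW) ∘ H¹(φ)` is `H¹` of the pair `(φ, W → W/TW)`.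
* **`localization_coresEisenstein_mem_ordinaryCore`** (`K` a number field, `v` a finite place, `Φ : OrdinaryFiltration ρ t v`
  an ordinary datum of a tower `(ρ k, t)`): under the same cocycle hypothesis along `φ = (Γ_{K_v} → Γ_K)` with
  `Fil = Φ.fil k`, the localisation at `v` of `coresEisenstein N [z]` lies in the strict ordinary core `Φ.ordinaryCore hm k` —
  the `v ∣ p` counterpart of `res_coresEisenstein_mem_unramifiedSubgroup`.

References: [NeukirchSchmidtWingberg2008] I §5 (1.5.6)–(1.5.7); [Howard2004HeegnerKolyvagin] §2.2 (Lemma 2.2.7, Prop. 2.2.8),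
§3.1 (`H¹_ord`), Def. 3.2.5–3.2.6; [GreenbergLNM1716] §2. No summit statement is proved here; BSD is not proved by any of this.
-/

noncomputable section

open scoped TensorProduct Topology ContRepresentation Classical
open Field CategoryTheory NumberField IsDedekindDomain

universe u

namespace Literature.NumberTheory.EllipticCurves

open Literature.NumberTheory.GaloisRepresentations

namespace ZpExtension

variable {K : Type u} [Field K] {p : ℕ} [hp : Fact p.Prime] (κ : ZpExtension K p)
variable {M : Type u} [AddCommGroup M] [TopologicalSpace M] [DiscreteTopology M]

/-! ## §1 Plumbing: the quotient coefficient morphism along `φ` -/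

section Plumbing

variable {M' : Type u} [AddCommGroup M'] [TopologicalSpace M'] [DiscreteTopology M']
  (X : DiscreteGaloisModule K M') {L : Type u} [Field L] (φ : absoluteGaloisGroup L →ₜ* absoluteGaloisGroup K)
  (TW : Submodule ℤ M') (hTW : ∀ σ : absoluteGaloisGroup L, TW ≤ TW.comap (ContinuousRep.restrict X φ σ))

/-- The composite coefficient morphism `idPairHom ≫ mkQHom` is the quotient map on elements. [folklore] -/
private theorem idPairHom_comp_mkQHom_hom_apply (x : M') :
    (idPairHom X φ ≫ ContinuousRep.mkQHom (ContinuousRep.restrict X φ) TW hTW).hom x = TW.mkQ x := by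
  rw [TopRep.hom_comp]
  rfl

/-- **`H¹(W → W/TW) ∘ H¹(φ) = H¹(φ, W → W/TW)`** on `H¹(K, W)`: the tree's `quotientMap` of the restricted module
`W|_φ` composed with the pull-back `galoisCohomology.pullback X φ` is Mathlib's `ContinuousCohomology.map` along the
compatible pair `(φ, W → W/TW)` (`idPairHom ≫ mkQHom`) — checked on cocycle representatives, where both are
`h ↦ z(φ h) mod TW`. [cite: SerreLocalFields1979, VII §5] -/
theorem quotientMap_pullback_eq_map (c : galoisCohomology X 1) :
    DiscreteGaloisModule.quotientMap (ContinuousRep.restrict X φ) TW hTW 1 (galoisCohomology.pullback X φ 1 c) =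
      ContinuousCohomology.map φ
        (idPairHom X φ ≫ ContinuousRep.mkQHom (ContinuousRep.restrict X φ) TW hTW) 1 c := by
  obtain ⟨F, rfl⟩ := oneCocycleClass_surjective _ c
  rw [map_oneCocycleClass, pullback_eq_map_idPairHom, map_oneCocycleClass]
  -- the tree's `quotientMap` is `ContinuousCohomology.map id` of the quotient morphism (definitionally)
  have hq : ∀ G : contOneCocycles (DiscreteGaloisModule.toTopRep (ContinuousRep.restrict X φ)),
      DiscreteGaloisModule.quotientMap (ContinuousRep.restrict X φ) TW hTW 1 (oneCocycleClass _ G) =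
        ContinuousCohomology.map (ContinuousMonoidHom.id (absoluteGaloisGroup L))
          (X := DiscreteGaloisModule.toTopRep (ContinuousRep.restrict X φ))
          (Y := DiscreteGaloisModule.toTopRep ((ContinuousRep.restrict X φ).quotient TW hTW))
          (TopRep.ofHom ⟨⟨TW.mkQ.toAddMonoidHom.toIntLinearMap, continuous_of_discreteTopology⟩,
            fun g ↦ ContinuousLinearMap.ext fun x ↦ rfl⟩) 1 (oneCocycleClass _ G) := fun _ ↦ rfl
  rw [hq, map_oneCocycleClass]
  congr 1

end Plumbing

/-! ## §2 `coresEisenstein` dies modulo a `Γ_L`-stable plus part along any `φ : Γ_L → Γ_K` -/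

section Pullback

variable (ρ : DiscreteGaloisModule K M) {m : ℕ} (hm : 1 ≤ m) (k : ℕ)
  (N : Subgroup (absoluteGaloisGroup K)) [N.Normal] (hN : N ≤ κ.layerSubgroup (eisensteinLevel (p := p) hm k))
  (hNo : IsOpen (N : Set (absoluteGaloisGroup K))) [Fintype (absoluteGaloisGroup K ⧸ N)]
  {L : Type u} [Field L] (φ : absoluteGaloisGroup L →ₜ* absoluteGaloisGroup K)
  (Fil : Submodule ℤ M) (TW : Submodule ℤ (IwasawaAlgebra.EisensteinCoeff.Twisted p m k M))
  (hTW : ∀ σ : absoluteGaloisGroup L, TW ≤ TW.comap (ContinuousRep.restrict (κ.eisensteinTwist ρ hm k) φ σ))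
  (htmul : ∀ (c : IwasawaAlgebra.EisensteinCoeff p m k) (a : M), a ∈ Fil →
    IwasawaAlgebra.EisensteinCoeff.Twisted.tmul c a ∈ TW)

include htmul in
set_option maxHeartbeats 800000 in
/-- **`coresEisenstein` dies modulo the plus part along `φ`.** If for every `g ∈ Γ_K` the conjugate `g · z` of the cocycle
`z` of `N` in `M` is, on `φ⁻¹N`, a coboundary MODULO `Fil` — `∃ y ∈ M, ∀ h ∈ φ⁻¹N, ρ(g) z(g⁻¹ φ(h) g) − (ρ(φ h) y − y) ∈ Fil` —
then `cor_N^{Γ_K}(1 ⊗ [z]) ∈ H¹(K, M ⊗ A_{m,k}(ψ))` maps to `0` in `H¹(Γ_L, (M ⊗ A_{m,k}(ψ)) / TW)` for every `Γ_L`-stable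
`TW ⊇ A_{m,k} ⊗ Fil`. (Mackey `map_cores_eq_zero`; `g · (1 ⊗ z) = (1+T)^{e(g)} • (1 ⊗ g·z)`; `Γ_J ⊇ N ⊇ φ(φ⁻¹N)` acts on
`1 ⊗ M` through `ρ`, so `φ(h) y − y` maps to the coboundary of `(1+T)^e • (1 ⊗ y)`, and `Fil` maps into `TW`.)
[cite: NeukirchSchmidtWingberg2008, I §5 (1.5.6)–(1.5.7)] [cite: Howard2004HeegnerKolyvagin, §2.2 and §3.1 (H¹_ord)] -/
theorem map_coresEisenstein_mkQ_eq_zero [Fintype (absoluteGaloisGroup L ⧸ N.comap (φ : _ →* _))]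
    (z : contOneCocycles (subgroupRep ρ.toTopRep N))
    (hz : ∀ g : absoluteGaloisGroup K, ∃ y : M, ∀ h : N.comap (φ : absoluteGaloisGroup L →* absoluteGaloisGroup K),
      ρ g (z.1 (subgroupConj N g (comapRestrict N φ h))) - (ρ (φ (h : absoluteGaloisGroup L)) y - y) ∈ Fil) :
    ContinuousCohomology.map φ
        (idPairHom (κ.eisensteinTwist ρ hm k) φ ≫
          ContinuousRep.mkQHom (ContinuousRep.restrict (κ.eisensteinTwist ρ hm k) φ) TW hTW) 1
        (κ.coresEisenstein ρ hm k N hN hNo (oneCocycleClass _ z)) = 0 := by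
  rw [coresEisenstein_apply]
  refine map_cores_eq_zero (κ.eisensteinTwist ρ hm k).toTopRep _ φ _ N hNo _ fun g ↦ ?_
  obtain ⟨y, hy⟩ := hz g
  rw [cohomologyMap_oneCocycleClass, conjMap_oneCocycleClass, map_oneCocycleClass, oneCocycleClass_eq_zero_iff]
  refine ⟨TW.mkQ (IwasawaAlgebra.EisensteinCoeff.onePlusT p m k ^ κ.twistExponent (eisensteinLevel (p := p) hm k) g •
    eisensteinUnitCoeff p m k y), fun h ↦ ?_⟩
  have hmem : (φ : absoluteGaloisGroup L →ₜ* absoluteGaloisGroup K) (h : absoluteGaloisGroup L) ∈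
      κ.layerSubgroup (eisensteinLevel (p := p) hm k) := hN h.2
  -- the value of the conjugate cocycle: a coboundary plus an element of `Fil`
  obtain ⟨f, hf, hfeq⟩ : ∃ f ∈ Fil, ρ g (z.1 (subgroupConj N g (comapRestrict N φ h))) =
      (ρ (φ (h : absoluteGaloisGroup L)) y - y) + f :=
    ⟨_, hy h, by abel⟩
  -- the value of the twisted cocycle `g · (1 ⊗ z)` at `φ h`, before passing to the quotient
  have hval : (κ.eisensteinTwist ρ hm k).toTopRep.ρ g
      (eisensteinUnitCoeff p m k (z.1 (subgroupConj N g (comapRestrict N φ h)))) =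
      (κ.eisensteinTwist ρ hm k (φ (h : absoluteGaloisGroup L))
          (IwasawaAlgebra.EisensteinCoeff.onePlusT p m k ^ κ.twistExponent (eisensteinLevel (p := p) hm k) g •
            eisensteinUnitCoeff p m k y) -
        IwasawaAlgebra.EisensteinCoeff.onePlusT p m k ^ κ.twistExponent (eisensteinLevel (p := p) hm k) g •
          eisensteinUnitCoeff p m k y) +
      IwasawaAlgebra.EisensteinCoeff.onePlusT p m k ^ κ.twistExponent (eisensteinLevel (p := p) hm k) g •
        eisensteinUnitCoeff p m k f := by
    rw [ContinuousRep.toTopRep_ρ_apply, eisensteinTwist_eisensteinUnitCoeff, hfeq, map_add, smul_add, map_sub,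
      smul_sub, κ.eisensteinTwist_apply_smul ρ hm k, κ.eisensteinTwist_eisensteinUnitCoeff_of_mem ρ hm k hmem]
  -- `(1+T)^e • (1 ⊗ f) ∈ TW`
  have hTWf : IwasawaAlgebra.EisensteinCoeff.onePlusT p m k ^ κ.twistExponent (eisensteinLevel (p := p) hm k) g •
      eisensteinUnitCoeff p m k f ∈ TW := by
    rw [eisensteinUnitCoeff_apply, IwasawaAlgebra.EisensteinCoeff.Twisted.smul_tmul]
    exact htmul _ f hf
  have hTW0 : TW.mkQ (IwasawaAlgebra.EisensteinCoeff.onePlusT p m k ^ κ.twistExponent (eisensteinLevel (p := p) hm k) g •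
      eisensteinUnitCoeff p m k f) = 0 := by
    rw [Submodule.mkQ_apply]
    exact (Submodule.Quotient.mk_eq_zero TW).mpr hTWf
  rw [contOneCocycles.pullback_apply, resPairHom_hom_apply, conj_pullback_apply, pullback_id_resIdHom_apply,
    eisensteinUnitCoeffHom_hom_apply, idPairHom_comp_mkQHom_hom_apply, hval, map_add, map_sub, hTW0, add_zero]
  rfl

include htmul in
/-- The same with the finiteness structure on `Γ_L ⧸ φ⁻¹N` supplied from `Γ_K ⧸ N` (`finite_quotientComap`).
[cite: NeukirchSchmidtWingberg2008, I §5 (1.5.6)–(1.5.7)] -/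
theorem map_coresEisenstein_mkQ_eq_zero' (z : contOneCocycles (subgroupRep ρ.toTopRep N))
    (hz : ∀ g : absoluteGaloisGroup K, ∃ y : M, ∀ h : N.comap (φ : absoluteGaloisGroup L →* absoluteGaloisGroup K),
      ρ g (z.1 (subgroupConj N g (comapRestrict N φ h))) - (ρ (φ (h : absoluteGaloisGroup L)) y - y) ∈ Fil) :
    ContinuousCohomology.map φ
        (idPairHom (κ.eisensteinTwist ρ hm k) φ ≫
          ContinuousRep.mkQHom (ContinuousRep.restrict (κ.eisensteinTwist ρ hm k) φ) TW hTW) 1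
        (κ.coresEisenstein ρ hm k N hN hNo (oneCocycleClass _ z)) = 0 := by
  haveI : Fintype (absoluteGaloisGroup L ⧸ N.comap (φ : absoluteGaloisGroup L →* absoluteGaloisGroup K)) :=
    @Fintype.ofFinite _ (finite_quotientComap N (φ : absoluteGaloisGroup L →* absoluteGaloisGroup K))
  exact κ.map_coresEisenstein_mkQ_eq_zero ρ hm k N hN hNo φ Fil TW hTW htmul z hz

end Pullback

/-! ## §3 At a finite place: the localisation of `coresEisenstein N θ` lies in the strict ordinary core -/

section Ordinary

variable [NumberField K] {M : ℕ → Type u} [∀ k, AddCommGroup (M k)] [∀ k, TopologicalSpace (M k)]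
  [∀ k, DiscreteTopology (M k)] (ρ : ∀ k, DiscreteGaloisModule K (M k))
  (t : ∀ k, (ρ (k + 1)).toContRepresentation →ⁱL (ρ k).toContRepresentation)
  {m : ℕ} (hm : 1 ≤ m) (k : ℕ)
  (N : Subgroup (absoluteGaloisGroup K)) [N.Normal] (hN : N ≤ κ.layerSubgroup (eisensteinLevel (p := p) hm k))
  (hNo : IsOpen (N : Set (absoluteGaloisGroup K))) [Fintype (absoluteGaloisGroup K ⧸ N)]
  {v : HeightOneSpectrum (𝓞 K)} (Φ : OrdinaryFiltration ρ t v)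

/-- **The localisation at `v` of `cor_N^{Γ_K}(1 ⊗ [z])` lies in the strict ordinary core** `Φ.ordinaryCore hm k =
ker (H¹(K_v, W_k) → H¹(K_v, W_k / Fil_v W_k))` whenever every conjugate `g · z` is, on `Γ_{K_v} ×_{Γ_K} N`, a coboundary
modulo `Fil_v M_k` — the `v ∣ p` counterpart of `res_coresEisenstein_mem_unramifiedSubgroup` (Howard's `H¹_ord` clause of
`𝔖 → H¹_{F_𝔮}(K, T_𝔮)` at the places above `p`; Greenberg's ordinary condition).
[cite: Howard2004HeegnerKolyvagin, §2.2 Lemma 2.2.7 and §3.1 (H¹_ord), Def. 3.2.6] [cite: GreenbergLNM1716, §2]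
[cite: NeukirchSchmidtWingberg2008, I §5 (1.5.6)–(1.5.7)] -/
theorem localization_coresEisenstein_mem_ordinaryCore (z : contOneCocycles (subgroupRep (ρ k).toTopRep N))
    (hz : ∀ g : absoluteGaloisGroup K, ∃ y : M k,
      ∀ h : N.comap ((absGaloisRestrict K (v.adicCompletion K) : absoluteGaloisGroup (v.adicCompletion K) →ₜ*
        absoluteGaloisGroup K) : absoluteGaloisGroup (v.adicCompletion K) →* absoluteGaloisGroup K),
      ρ k g (z.1 (subgroupConj N g (comapRestrict N (absGaloisRestrict K (v.adicCompletion K)) h))) -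
        (ρ k (absGaloisRestrict K (v.adicCompletion K) (h : absoluteGaloisGroup (v.adicCompletion K))) y - y) ∈ Φ.fil k) :
    galoisCohomology.localization (κ.eisensteinTwist (ρ k) hm k) (Sum.inr v) 1
        (κ.coresEisenstein (ρ k) hm k N hN hNo (oneCocycleClass _ z)) ∈ Φ.ordinaryCore hm k := by
  rw [OrdinaryFiltration.mem_ordinaryCore_iff]
  change DiscreteGaloisModule.quotientMap (ContinuousRep.restrict (κ.eisensteinTwist (ρ k) hm k)
      (absGaloisRestrict K (v.adicCompletion K))) (Φ.twistedFil k) (Φ.twistedFil_le_comap hm k) 1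
    (galoisCohomology.pullback (κ.eisensteinTwist (ρ k) hm k) (absGaloisRestrict K (v.adicCompletion K)) 1
      (κ.coresEisenstein (ρ k) hm k N hN hNo (oneCocycleClass _ z))) = 0
  rw [quotientMap_pullback_eq_map]
  exact κ.map_coresEisenstein_mkQ_eq_zero' (ρ k) hm k N hN hNo (absGaloisRestrict K (v.adicCompletion K)) (Φ.fil k)
    (Φ.twistedFil k) (Φ.twistedFil_le_comap hm k) (fun c a ha ↦ Φ.tmul_mem_twistedFil k c ha) z hz

end Ordinary

end ZpExtension

end Literature.NumberTheory.EllipticCurves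

end
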